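import Summits.QuantumFields.BalabanUV.Beta.GAN24.CouplingLetterWordInputs
import Summits.QuantumFields.BalabanUV.Beta.GAN24.BackgroundExpansionAllOrders

/-!
# `BalabanUV.Beta.GAN24.CouplingLetterDiagrams` — binder row G-an2-4 ∕ (CONV-C), route R7 «TWO CURRENCIES», PART 238: EVERY DIAGRAM IN COUPLING LETTERS — every finite
# `ℂ`-combination of finite products of the letters `c_k⁻¹` and `X_{w,k}` (words in coupling letters `A_i = P(V₁ᵢ) + P(V₂ᵢ)ᴴ + diag Wᵢ`: first order + ADJOINT placement + ZEROTH
# order, the class of the exact abelian covariant Laplacian `Δ^U − Δ^1`, NE2's `covPert_eq`) has the INPUT triple and hence the β-cell's whole `LimitRate` END on `ℤ^d`, modulo ONLY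
# EL₁ of the backgrounds.  PART 160 §2 VERBATIM over PART 237's `couplingWord_inputs` (PART 160 §1 — the closure of the INPUT triple under `List.prod` ∕ `Finset.sum` — is GENERIC
# and imported BY NAME); PART 239 reads the Taylor coefficients along `u ↦ Δ_a + u·A` and the covariant instance on it (unit b2b-balaban-gan24-p3, gen 65; v1; generator
# `HOME/b2b-balaban-gan24-p3/gen65/records/gen/gen238.py` over the tree text of PART 160)

NOT IN PRINT; OUR PROOF ([folklore] bookkeeping BY NAME over PART 160 §1 (`list_prod_inputs`, `sum_inputs`), PART 237 (`couplingWord_inputs`), PART 143 (`invCov_inputs`),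
PART 140 (`conv_of_decay_of_tendsto`); [Balaban1987RG1] (1.21)–(1.22) p. 264 LOCATE the shapes; nothing printed is a hypothesis).
HONEST FRAMING (cell contract, verbatim): «discharging `BetaPertH` makes Bałaban's UV stability UNCONDITIONAL — a real constructive-QFT result; it is NOT the
continuum limit and NOT the Clay problem.»  HONEST DEPENDENCY (verbatim): «continuum YM on T⁴ ⇐ BetaPertH ∧ nine spine estimates (0/9 proved); BetaPertH ⇐
(D1) ∧ (D4) ∧ CAP+tail; G-an2-4 gates asym, D1 and NE2/3/4.»

WHAT THIS FILE PROVES (0 sorry, 0 `def`; `d ≥ 3`, `L ≥ 2`, `a > 0`, `μ ≠ ν`, even cubic volumes `2(t+1)`; `A_i = Pmodel V₁ᵢ + (Pmodel V₂ᵢ)ᴴ + diag Wᵢ` with `V₁ᵢ, V₂ᵢ` Lipschitz `(α, β)`,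
`Wᵢ` bounded `(α′, β′)` uniformly in the volume, EL₁ displayed; letters `o : Option (List σ)`: `none ↦ c_k⁻¹`, `some w ↦ X_{w,k}`):
* **`couplingLetter_inputs`**, **`couplingDiagram_inputs`** (`list_prod_inputs`), **`couplingDiagramSum_inputs`** (`sum_inputs`) — the INPUT triple ((UD), (SR), EL₂);
* **`conv_couplingDiagramSum_of_tendsto_background`**, `conv_couplingDiagram_of_tendsto_background` — `∃ κ > 0, B, B′ ≥ 0, Π` with `IsInfiniteVolumeLimit`, `UniformDecay Π μ ν B (κ∕d)`,
  `StepRate Π μ ν B′ (κ∕d) (√(L⁻¹))`, `KernelInputs d Π`, `∀ k, |secondMoment (Π k) μ ν − secondMoment (limKernelOf Π) μ ν| ≤ β′_d(B′∕(1−√(L⁻¹)), κ∕d)·(√(L⁻¹))^k`.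
WHAT IT DOES NOT DO: the Taylor reading and the covariant instance (PART 239); `d ≤ 2` ∕ odd volumes.  SUPPLIER work; NEVER «G-an2-4 closed»; NOT (CONV-C), NOT D1, NOT `BetaPertH`,
NOT continuum, NOT Clay.  Records: `HOME/b2b-balaban-gan24-p3/gen65/README.md`.
-/

noncomputable section

open scoped BigOperators ComplexConjugate Matrix Matrix.Norms.L2Operator
open Filter Topology

namespace Summit.QuantumFields.BalabanUV.Beta.GAN24.CouplingLetterDiagrams

open Literature.MathematicalPhysics.QuantumFieldTheory.Balaban1983to89
open Literature.MathematicalPhysics.QuantumFieldTheory.Balaban1983to89.B5G183RateUnitTower (lev)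
open Literature.MathematicalPhysics.QuantumFieldTheory.Balaban1983to89.B12Sec2to5 (betaPrime510)
open Literature.MathematicalPhysics.QuantumFieldTheory.Balaban1983to89.Beta (Site IsInfiniteVolumeLimit)
open Literature.MathematicalPhysics.QuantumFieldTheory.Balaban1983to89.Beta.FreeLegDictionary (cubic)
open Literature.MathematicalPhysics.QuantumFieldTheory.Balaban1983to89.Beta.BlockKernelVolumeSockets (evenPeriod tendsto_evenPeriod)
open Literature.MathematicalPhysics.QuantumFieldTheory.Balaban1983to89.Beta.VectorTails (castT)
open Literature.MathematicalPhysics.QuantumFieldTheory.Balaban1983to89.Beta.LimitRate (StepRate limKernelOf KernelInputs)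
open Summit.QuantumFields.BalabanUV.T4Continuum
open Summit.QuantumFields.BalabanUV.T4Continuum.CovariantAveragingTower (avgTow)
open Summit.QuantumFields.BalabanUV.T4Continuum.BalabanAveragedTowerUnit (idx QBlev calGlev unitCovB)
open Summit.QuantumFields.BalabanUV.T4Continuum.BalabanAveragedCoerciveTower (unitIdx)
open Summit.QuantumFields.BalabanUV.T4Continuum.FirstOrderBackgroundModel (LipschitzBackground Pmodel)
open Summit.QuantumFields.BalabanUV.T4Continuum.PerturbationAlgebra (BoundedBackground)
open Summit.QuantumFields.BalabanUV.T4Continuum.CTKingTowerWeights (distK)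
open Summit.QuantumFields.BalabanUV.T4Continuum.DecayRateInterpolation (EntryDecay TwoLevelDecayRate)
open Summit.QuantumFields.BalabanUV.Beta.GAN24.DiagramVolumeLimit (conv_of_decay_of_tendsto)
open Summit.QuantumFields.BalabanUV.Beta.GAN24.DiagramVolumeLimitSandwich (invCov_inputs)
open Summit.QuantumFields.BalabanUV.Beta.GAN24.BackgroundExpansionAllOrders (list_prod_inputs sum_inputs)
open Summit.QuantumFields.BalabanUV.Beta.GAN24.CouplingLetterWordInputs (couplingWord_inputs)

variable {d : ℕ} (L : ℕ) [NeZero L] (a : ℝ) (ha : 0 < a)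

/-! ## §1 The letters `c_k⁻¹`, `X_{w,k}` in coupling letters; every diagram; every finite linear combination of diagrams; the END -/

section Diagrams

variable {σ : Type*} [Nonempty σ] {α β α' β' : ℝ} {V₁ V₂ : σ → (t : ℕ) → (k : ℕ) → Fin d → (idx L (cubic d (evenPeriod t)) k → ℂ)}
  {W : σ → (t : ℕ) → (k : ℕ) → (idx L (cubic d (evenPeriod t)) k → ℂ)}

/-- INPUTS of a LETTER: `c_k⁻¹` (PART 143's `invCov_inputs`) or `X_{w,k}` (PART 237's `couplingWord_inputs`). [our proof] -/
theorem couplingLetter_inputs (hL : 2 ≤ L) (hd : 3 ≤ d) (hV₁ : ∀ i t, LipschitzBackground L (cubic d (evenPeriod t)) (V₁ i t) α β)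
    (hV₂ : ∀ i t, LipschitzBackground L (cubic d (evenPeriod t)) (V₂ i t) α β) (hW : ∀ i t, BoundedBackground L (cubic d (evenPeriod t)) (W i t) α' β')
    (hV₁1 : ∀ i k (μ f : Fin d) (z : Fin d → ℤ), ∃ s : ℂ, Tendsto (fun t => V₁ i t k μ (castT (cubic d (lev L k * evenPeriod t)) z, f)) atTop (𝓝 s))
    (hV₂1 : ∀ i k (μ f : Fin d) (z : Fin d → ℤ), ∃ s : ℂ, Tendsto (fun t => V₂ i t k μ (castT (cubic d (lev L k * evenPeriod t)) z, f)) atTop (𝓝 s))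
    (hW1 : ∀ i k (f : Fin d) (z : Fin d → ℤ), ∃ s : ℂ, Tendsto (fun t => W i t k (castT (cubic d (lev L k * evenPeriod t)) z, f)) atTop (𝓝 s))
    (o : Option (List σ)) :
    ∃ κ B B' : ℝ, 0 < κ ∧ 0 ≤ B ∧ 0 ≤ B' ∧
      (∀ t k, EntryDecay (distK L (cubic d (evenPeriod t)))
        (o.elim (fun t k => (unitCovB L (cubic d (evenPeriod t)) a ha k)⁻¹)
          (fun w t k => avgTow (QBlev L (cubic d (evenPeriod t))) ((L : ℝ) ^ d)
            (fun k' => List.foldr (fun i N => calGlev L (cubic d (evenPeriod t)) a ha k' * (Pmodel L (cubic d (evenPeriod t)) (V₁ i t) k' + (Pmodel L (cubic d (evenPeriod t)) (V₂ i t) k')ᴴ + Matrix.diagonal (W i t k')) * N)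
              (calGlev L (cubic d (evenPeriod t)) a ha k') w) k) t k) B κ) ∧
      (∀ t, TwoLevelDecayRate (distK L (cubic d (evenPeriod t)))
        (o.elim (fun t k => (unitCovB L (cubic d (evenPeriod t)) a ha k)⁻¹)
          (fun w t k => avgTow (QBlev L (cubic d (evenPeriod t))) ((L : ℝ) ^ d)
            (fun k' => List.foldr (fun i N => calGlev L (cubic d (evenPeriod t)) a ha k' * (Pmodel L (cubic d (evenPeriod t)) (V₁ i t) k' + (Pmodel L (cubic d (evenPeriod t)) (V₂ i t) k')ᴴ + Matrix.diagonal (W i t k')) * N)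
              (calGlev L (cubic d (evenPeriod t)) a ha k') w) k) t) B' κ (Real.sqrt ((L : ℝ)⁻¹))) ∧
      (∀ k μ ν (z z' : Fin d → ℤ), ∃ s' : ℂ, Tendsto (fun t =>
        o.elim (fun t k => (unitCovB L (cubic d (evenPeriod t)) a ha k)⁻¹)
          (fun w t k => avgTow (QBlev L (cubic d (evenPeriod t))) ((L : ℝ) ^ d)
            (fun k' => List.foldr (fun i N => calGlev L (cubic d (evenPeriod t)) a ha k' * (Pmodel L (cubic d (evenPeriod t)) (V₁ i t) k' + (Pmodel L (cubic d (evenPeriod t)) (V₂ i t) k')ᴴ + Matrix.diagonal (W i t k')) * N)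
              (calGlev L (cubic d (evenPeriod t)) a ha k') w) k) t k
        ((unitIdx L (cubic d (evenPeriod t))).symm (castT (cubic d (evenPeriod t)) z, μ)) ((unitIdx L (cubic d (evenPeriod t))).symm (castT (cubic d (evenPeriod t)) z', ν)))
        atTop (𝓝 s')) := by
  cases o with
  | none =>
    obtain ⟨κ, B, B', hκ, hB, hB', hud, hsr, hel⟩ := invCov_inputs L a ha hL hd
    exact ⟨κ, B, B', hκ, hB, hB', fun t k => hud (evenPeriod t) k, fun t => hsr (evenPeriod t), hel⟩
  | some w =>
    obtain ⟨κ, B, B', hκ, hB, hB', hud, hsr, hel⟩ := couplingWord_inputs L a ha hL hd hV₁ hV₂ hW hV₁1 hV₂1 hW1 w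
    exact ⟨κ, B, B', hκ, hB, hB', hud, hsr, hel⟩

/-- **`couplingDiagram_inputs` — EVERY DIAGRAM HAS THE INPUT TRIPLE** [our proof] (`L ≥ 2`, `d ≥ 3`, even cubic volumes; EL₁ of the backgrounds DISPLAYED): for every `ℓ : List (Option (List σ))`
the pointwise product of its letters (`none ↦ c_k⁻¹`, `some w ↦ X_{w,k}`) has INPUTS — `list_prod_inputs` on `couplingLetter_inputs`. -/
theorem couplingDiagram_inputs (hL : 2 ≤ L) (hd : 3 ≤ d) (hV₁ : ∀ i t, LipschitzBackground L (cubic d (evenPeriod t)) (V₁ i t) α β)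
    (hV₂ : ∀ i t, LipschitzBackground L (cubic d (evenPeriod t)) (V₂ i t) α β) (hW : ∀ i t, BoundedBackground L (cubic d (evenPeriod t)) (W i t) α' β')
    (hV₁1 : ∀ i k (μ f : Fin d) (z : Fin d → ℤ), ∃ s : ℂ, Tendsto (fun t => V₁ i t k μ (castT (cubic d (lev L k * evenPeriod t)) z, f)) atTop (𝓝 s))
    (hV₂1 : ∀ i k (μ f : Fin d) (z : Fin d → ℤ), ∃ s : ℂ, Tendsto (fun t => V₂ i t k μ (castT (cubic d (lev L k * evenPeriod t)) z, f)) atTop (𝓝 s))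
    (hW1 : ∀ i k (f : Fin d) (z : Fin d → ℤ), ∃ s : ℂ, Tendsto (fun t => W i t k (castT (cubic d (lev L k * evenPeriod t)) z, f)) atTop (𝓝 s))
    (ℓ : List (Option (List σ))) :
    ∃ κ B B' : ℝ, 0 < κ ∧ 0 ≤ B ∧ 0 ≤ B' ∧
      (∀ t k, EntryDecay (distK L (cubic d (evenPeriod t)))
        ((ℓ.map fun o => o.elim (fun t k => (unitCovB L (cubic d (evenPeriod t)) a ha k)⁻¹)
          (fun w t k => avgTow (QBlev L (cubic d (evenPeriod t))) ((L : ℝ) ^ d)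
            (fun k' => List.foldr (fun i N => calGlev L (cubic d (evenPeriod t)) a ha k' * (Pmodel L (cubic d (evenPeriod t)) (V₁ i t) k' + (Pmodel L (cubic d (evenPeriod t)) (V₂ i t) k')ᴴ + Matrix.diagonal (W i t k')) * N)
              (calGlev L (cubic d (evenPeriod t)) a ha k') w) k)).prod t k) B κ) ∧
      (∀ t, TwoLevelDecayRate (distK L (cubic d (evenPeriod t)))
        ((ℓ.map fun o => o.elim (fun t k => (unitCovB L (cubic d (evenPeriod t)) a ha k)⁻¹)
          (fun w t k => avgTow (QBlev L (cubic d (evenPeriod t))) ((L : ℝ) ^ d)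
            (fun k' => List.foldr (fun i N => calGlev L (cubic d (evenPeriod t)) a ha k' * (Pmodel L (cubic d (evenPeriod t)) (V₁ i t) k' + (Pmodel L (cubic d (evenPeriod t)) (V₂ i t) k')ᴴ + Matrix.diagonal (W i t k')) * N)
              (calGlev L (cubic d (evenPeriod t)) a ha k') w) k)).prod t) B' κ (Real.sqrt ((L : ℝ)⁻¹))) ∧
      (∀ k μ ν (z z' : Fin d → ℤ), ∃ s' : ℂ, Tendsto (fun t =>
        (ℓ.map fun o => o.elim (fun t k => (unitCovB L (cubic d (evenPeriod t)) a ha k)⁻¹)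
          (fun w t k => avgTow (QBlev L (cubic d (evenPeriod t))) ((L : ℝ) ^ d)
            (fun k' => List.foldr (fun i N => calGlev L (cubic d (evenPeriod t)) a ha k' * (Pmodel L (cubic d (evenPeriod t)) (V₁ i t) k' + (Pmodel L (cubic d (evenPeriod t)) (V₂ i t) k')ᴴ + Matrix.diagonal (W i t k')) * N)
              (calGlev L (cubic d (evenPeriod t)) a ha k') w) k)).prod t k
        ((unitIdx L (cubic d (evenPeriod t))).symm (castT (cubic d (evenPeriod t)) z, μ)) ((unitIdx L (cubic d (evenPeriod t))).symm (castT (cubic d (evenPeriod t)) z', ν)))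
        atTop (𝓝 s')) := by
  have hd2 : 2 ≤ d := le_trans (by norm_num) hd
  refine list_prod_inputs L hd2 tendsto_evenPeriod (Real.sqrt_nonneg _) _ fun X hX => ?_
  obtain ⟨o, -, rfl⟩ := List.mem_map.mp hX
  exact couplingLetter_inputs L a ha hL hd hV₁ hV₂ hW hV₁1 hV₂1 hW1 o

/-- **`couplingDiagramSum_inputs` — EVERY FINITE LINEAR COMBINATION OF DIAGRAMS HAS THE INPUT TRIPLE** [our proof]: `sum_inputs` on `couplingDiagram_inputs`. -/
theorem couplingDiagramSum_inputs (hL : 2 ≤ L) (hd : 3 ≤ d) (hV₁ : ∀ i t, LipschitzBackground L (cubic d (evenPeriod t)) (V₁ i t) α β)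
    (hV₂ : ∀ i t, LipschitzBackground L (cubic d (evenPeriod t)) (V₂ i t) α β) (hW : ∀ i t, BoundedBackground L (cubic d (evenPeriod t)) (W i t) α' β')
    (hV₁1 : ∀ i k (μ f : Fin d) (z : Fin d → ℤ), ∃ s : ℂ, Tendsto (fun t => V₁ i t k μ (castT (cubic d (lev L k * evenPeriod t)) z, f)) atTop (𝓝 s))
    (hV₂1 : ∀ i k (μ f : Fin d) (z : Fin d → ℤ), ∃ s : ℂ, Tendsto (fun t => V₂ i t k μ (castT (cubic d (lev L k * evenPeriod t)) z, f)) atTop (𝓝 s))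
    (hW1 : ∀ i k (f : Fin d) (z : Fin d → ℤ), ∃ s : ℂ, Tendsto (fun t => W i t k (castT (cubic d (lev L k * evenPeriod t)) z, f)) atTop (𝓝 s))
    {J : Type*} (s : Finset J) (coef : J → ℂ) (ℓ : J → List (Option (List σ))) :
    ∃ κ B B' : ℝ, 0 < κ ∧ 0 ≤ B ∧ 0 ≤ B' ∧
      (∀ t k, EntryDecay (distK L (cubic d (evenPeriod t)))
        ((∑ j ∈ s, coef j • ((ℓ j).map fun o => o.elim (fun t k => (unitCovB L (cubic d (evenPeriod t)) a ha k)⁻¹)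
          (fun w t k => avgTow (QBlev L (cubic d (evenPeriod t))) ((L : ℝ) ^ d)
            (fun k' => List.foldr (fun i N => calGlev L (cubic d (evenPeriod t)) a ha k' * (Pmodel L (cubic d (evenPeriod t)) (V₁ i t) k' + (Pmodel L (cubic d (evenPeriod t)) (V₂ i t) k')ᴴ + Matrix.diagonal (W i t k')) * N)
              (calGlev L (cubic d (evenPeriod t)) a ha k') w) k)).prod) t k) B κ) ∧
      (∀ t, TwoLevelDecayRate (distK L (cubic d (evenPeriod t)))
        ((∑ j ∈ s, coef j • ((ℓ j).map fun o => o.elim (fun t k => (unitCovB L (cubic d (evenPeriod t)) a ha k)⁻¹)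
          (fun w t k => avgTow (QBlev L (cubic d (evenPeriod t))) ((L : ℝ) ^ d)
            (fun k' => List.foldr (fun i N => calGlev L (cubic d (evenPeriod t)) a ha k' * (Pmodel L (cubic d (evenPeriod t)) (V₁ i t) k' + (Pmodel L (cubic d (evenPeriod t)) (V₂ i t) k')ᴴ + Matrix.diagonal (W i t k')) * N)
              (calGlev L (cubic d (evenPeriod t)) a ha k') w) k)).prod) t) B' κ (Real.sqrt ((L : ℝ)⁻¹))) ∧
      (∀ k μ ν (z z' : Fin d → ℤ), ∃ s' : ℂ, Tendsto (fun t =>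
        (∑ j ∈ s, coef j • ((ℓ j).map fun o => o.elim (fun t k => (unitCovB L (cubic d (evenPeriod t)) a ha k)⁻¹)
          (fun w t k => avgTow (QBlev L (cubic d (evenPeriod t))) ((L : ℝ) ^ d)
            (fun k' => List.foldr (fun i N => calGlev L (cubic d (evenPeriod t)) a ha k' * (Pmodel L (cubic d (evenPeriod t)) (V₁ i t) k' + (Pmodel L (cubic d (evenPeriod t)) (V₂ i t) k')ᴴ + Matrix.diagonal (W i t k')) * N)
              (calGlev L (cubic d (evenPeriod t)) a ha k') w) k)).prod) t k
        ((unitIdx L (cubic d (evenPeriod t))).symm (castT (cubic d (evenPeriod t)) z, μ)) ((unitIdx L (cubic d (evenPeriod t))).symm (castT (cubic d (evenPeriod t)) z', ν)))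
        atTop (𝓝 s')) :=
  sum_inputs L (Real.sqrt_nonneg _) s coef _ fun j _ => couplingDiagram_inputs L a ha hL hd hV₁ hV₂ hW hV₁1 hV₂1 hW1 (ℓ j)

/-- **`conv_couplingDiagramSum_of_tendsto_background` — THE BACKGROUND EXPANSION OF THE EFFECTIVE FORM TO ALL ORDERS, ON `ℤ^d`, MODULO ONLY THE BACKGROUNDS' POINTWISE LIMITS** [our proof]
(`d ≥ 3`, `L ≥ 2`, `a > 0`, `μ ≠ ν`, even cubic volumes `2(t+1)`, `σ` non-empty; a family `V_{i,t}` of volume-indexed Lipschitz backgrounds with common `(α, β)` DISPLAYING ONLY EL₁):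
EVERY finite `ℂ`-linear combination `Σ_{j ∈ s} a_j • Π_{o ∈ ℓ_j} letter(o)` of diagrams in the letters `c_k⁻¹` and `X_{w,k}` (any words `w`) has `∃ κ > 0, B, B′ ≥ 0, Π` with
`IsInfiniteVolumeLimit`, `UniformDecay Π μ ν B (κ∕d)`, `StepRate Π μ ν B′ (κ∕d) (√(L⁻¹))`, `KernelInputs d Π`, `∀ k, |secondMoment (Π k) μ ν − secondMoment (limKernelOf Π) μ ν| ≤
β′_d(B′∕(1−√(L⁻¹)), κ∕d)·(√(L⁻¹))^k` — `couplingDiagramSum_inputs` + PART 140's generic END.  Every mixed Taylor coefficient `∂_{t_{i₁}}⋯∂_{t_{i_n}}Σ_k(t)|₀` of `Σ_k(t) = c_k(t)⁻¹ − a″1` is such a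
combination (PART 157: `Σ̈_k = 2·[none, some [i], none, some [i], none] − 2·[none, some [i,i], none]`). [cite: Balaban1987RG1, (1.21)–(1.22) p.264 (shapes)] -/
theorem conv_couplingDiagramSum_of_tendsto_background (hL : 2 ≤ L) (hd : 3 ≤ d) {μ ν : Fin d} (hne : μ ≠ ν)
    (hV₁ : ∀ i t, LipschitzBackground L (cubic d (evenPeriod t)) (V₁ i t) α β)
    (hV₂ : ∀ i t, LipschitzBackground L (cubic d (evenPeriod t)) (V₂ i t) α β) (hW : ∀ i t, BoundedBackground L (cubic d (evenPeriod t)) (W i t) α' β')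
    (hV₁1 : ∀ i k (μ f : Fin d) (z : Fin d → ℤ), ∃ s : ℂ, Tendsto (fun t => V₁ i t k μ (castT (cubic d (lev L k * evenPeriod t)) z, f)) atTop (𝓝 s))
    (hV₂1 : ∀ i k (μ f : Fin d) (z : Fin d → ℤ), ∃ s : ℂ, Tendsto (fun t => V₂ i t k μ (castT (cubic d (lev L k * evenPeriod t)) z, f)) atTop (𝓝 s))
    (hW1 : ∀ i k (f : Fin d) (z : Fin d → ℤ), ∃ s : ℂ, Tendsto (fun t => W i t k (castT (cubic d (lev L k * evenPeriod t)) z, f)) atTop (𝓝 s))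
    {J : Type*} (s : Finset J) (coef : J → ℂ) (ℓ : J → List (Option (List σ))) :
    ∃ κ B B' : ℝ, 0 < κ ∧ 0 ≤ B ∧ 0 ≤ B' ∧ ∃ Pinf : ℕ → B12Beta.Kernel d,
      (∀ k, IsInfiniteVolumeLimit evenPeriod
        (fun t μ' ν' (z : Site d (evenPeriod t)) =>
          ((∑ j ∈ s, coef j • ((ℓ j).map fun o => o.elim (fun t k => (unitCovB L (cubic d (evenPeriod t)) a ha k)⁻¹)
            (fun w t k => avgTow (QBlev L (cubic d (evenPeriod t))) ((L : ℝ) ^ d)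
              (fun k' => List.foldr (fun i N => calGlev L (cubic d (evenPeriod t)) a ha k' * (Pmodel L (cubic d (evenPeriod t)) (V₁ i t) k' + (Pmodel L (cubic d (evenPeriod t)) (V₂ i t) k')ᴴ + Matrix.diagonal (W i t k')) * N)
                (calGlev L (cubic d (evenPeriod t)) a ha k') w) k)).prod) t k
          ((unitIdx L (cubic d (evenPeriod t))).symm (z, μ')) ((unitIdx L (cubic d (evenPeriod t))).symm (0, ν'))).re) (Pinf k)) ∧
      Beta.LimitRate.UniformDecay Pinf μ ν B (κ / d) ∧ StepRate Pinf μ ν B' (κ / d) (Real.sqrt ((L : ℝ)⁻¹)) ∧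
      (∃ K : KernelInputs d Pinf, K.θ = Real.sqrt ((L : ℝ)⁻¹) ∧ K.c₀ = betaPrime510 d (B' / (1 - Real.sqrt ((L : ℝ)⁻¹))) (κ / d) ∧ K.Pinf = limKernelOf Pinf ∧ K.μ = μ ∧ K.ν = ν) ∧
      (∀ k, |B12Beta.secondMoment (Pinf k) μ ν - B12Beta.secondMoment (limKernelOf Pinf) μ ν|
          ≤ betaPrime510 d (B' / (1 - Real.sqrt ((L : ℝ)⁻¹))) (κ / d) * Real.sqrt ((L : ℝ)⁻¹) ^ k) := by
  have hd1 : 1 ≤ d := le_trans (by norm_num) hd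
  have hL1 : (1 : ℝ) < L := by exact_mod_cast (lt_of_lt_of_le one_lt_two hL : 1 < L)
  have hθ1 : Real.sqrt ((L : ℝ)⁻¹) < 1 := by
    rw [show (1 : ℝ) = Real.sqrt 1 from Real.sqrt_one.symm]
    exact Real.sqrt_lt_sqrt (inv_nonneg.mpr (Nat.cast_nonneg _)) (inv_lt_one_of_one_lt₀ hL1)
  obtain ⟨κ, B, B', hκ, hB, hB', hud, hsr, hel⟩ := couplingDiagramSum_inputs L a ha hL hd hV₁ hV₂ hW hV₁1 hV₂1 hW1 s coef ℓ
  have hlim := fun k (μ' ν' : Fin d) (z : Fin d → ℤ) => by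
    have h := hel k μ' ν' z 0
    have e0 : ∀ t, castT (cubic d (evenPeriod t)) (0 : Fin d → ℤ) = 0 := fun t => by funext i; simp [castT]
    simp only [e0] at h
    exact h
  obtain ⟨Pinf, hP⟩ := conv_of_decay_of_tendsto L hd1 tendsto_evenPeriod hκ (Real.sqrt_nonneg _) hθ1 hud hsr hlim hne
  exact ⟨κ, B, B', hκ, hB, hB', Pinf, hP⟩

/-- **`conv_couplingDiagram_of_tendsto_background`** — the same END for ONE diagram `ℓ` (the combination over `{ℓ}` with coefficient `1`). [our proof] -/
theorem conv_couplingDiagram_of_tendsto_background (hL : 2 ≤ L) (hd : 3 ≤ d) {μ ν : Fin d} (hne : μ ≠ ν)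
    (hV₁ : ∀ i t, LipschitzBackground L (cubic d (evenPeriod t)) (V₁ i t) α β)
    (hV₂ : ∀ i t, LipschitzBackground L (cubic d (evenPeriod t)) (V₂ i t) α β) (hW : ∀ i t, BoundedBackground L (cubic d (evenPeriod t)) (W i t) α' β')
    (hV₁1 : ∀ i k (μ f : Fin d) (z : Fin d → ℤ), ∃ s : ℂ, Tendsto (fun t => V₁ i t k μ (castT (cubic d (lev L k * evenPeriod t)) z, f)) atTop (𝓝 s))
    (hV₂1 : ∀ i k (μ f : Fin d) (z : Fin d → ℤ), ∃ s : ℂ, Tendsto (fun t => V₂ i t k μ (castT (cubic d (lev L k * evenPeriod t)) z, f)) atTop (𝓝 s))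
    (hW1 : ∀ i k (f : Fin d) (z : Fin d → ℤ), ∃ s : ℂ, Tendsto (fun t => W i t k (castT (cubic d (lev L k * evenPeriod t)) z, f)) atTop (𝓝 s))
    (ℓ : List (Option (List σ))) :
    ∃ κ B B' : ℝ, 0 < κ ∧ 0 ≤ B ∧ 0 ≤ B' ∧ ∃ Pinf : ℕ → B12Beta.Kernel d,
      (∀ k, IsInfiniteVolumeLimit evenPeriod
        (fun t μ' ν' (z : Site d (evenPeriod t)) =>
          ((ℓ.map fun o => o.elim (fun t k => (unitCovB L (cubic d (evenPeriod t)) a ha k)⁻¹)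
            (fun w t k => avgTow (QBlev L (cubic d (evenPeriod t))) ((L : ℝ) ^ d)
              (fun k' => List.foldr (fun i N => calGlev L (cubic d (evenPeriod t)) a ha k' * (Pmodel L (cubic d (evenPeriod t)) (V₁ i t) k' + (Pmodel L (cubic d (evenPeriod t)) (V₂ i t) k')ᴴ + Matrix.diagonal (W i t k')) * N)
                (calGlev L (cubic d (evenPeriod t)) a ha k') w) k)).prod t k
          ((unitIdx L (cubic d (evenPeriod t))).symm (z, μ')) ((unitIdx L (cubic d (evenPeriod t))).symm (0, ν'))).re) (Pinf k)) ∧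
      Beta.LimitRate.UniformDecay Pinf μ ν B (κ / d) ∧ StepRate Pinf μ ν B' (κ / d) (Real.sqrt ((L : ℝ)⁻¹)) ∧
      (∃ K : KernelInputs d Pinf, K.θ = Real.sqrt ((L : ℝ)⁻¹) ∧ K.c₀ = betaPrime510 d (B' / (1 - Real.sqrt ((L : ℝ)⁻¹))) (κ / d) ∧ K.Pinf = limKernelOf Pinf ∧ K.μ = μ ∧ K.ν = ν) ∧
      (∀ k, |B12Beta.secondMoment (Pinf k) μ ν - B12Beta.secondMoment (limKernelOf Pinf) μ ν|
          ≤ betaPrime510 d (B' / (1 - Real.sqrt ((L : ℝ)⁻¹))) (κ / d) * Real.sqrt ((L : ℝ)⁻¹) ^ k) := by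
  have hd1 : 1 ≤ d := le_trans (by norm_num) hd
  have hL1 : (1 : ℝ) < L := by exact_mod_cast (lt_of_lt_of_le one_lt_two hL : 1 < L)
  have hθ1 : Real.sqrt ((L : ℝ)⁻¹) < 1 := by
    rw [show (1 : ℝ) = Real.sqrt 1 from Real.sqrt_one.symm]
    exact Real.sqrt_lt_sqrt (inv_nonneg.mpr (Nat.cast_nonneg _)) (inv_lt_one_of_one_lt₀ hL1)
  obtain ⟨κ, B, B', hκ, hB, hB', hud, hsr, hel⟩ := couplingDiagram_inputs L a ha hL hd hV₁ hV₂ hW hV₁1 hV₂1 hW1 ℓ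
  have hlim := fun k (μ' ν' : Fin d) (z : Fin d → ℤ) => by
    have h := hel k μ' ν' z 0
    have e0 : ∀ t, castT (cubic d (evenPeriod t)) (0 : Fin d → ℤ) = 0 := fun t => by funext i; simp [castT]
    simp only [e0] at h
    exact h
  obtain ⟨Pinf, hP⟩ := conv_of_decay_of_tendsto L hd1 tendsto_evenPeriod hκ (Real.sqrt_nonneg _) hθ1 hud hsr hlim hne
  exact ⟨κ, B, B', hκ, hB, hB', Pinf, hP⟩

end Diagrams

end Summit.QuantumFields.BalabanUV.Beta.GAN24.CouplingLetterDiagrams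

end
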